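import Summits.Ventures.PercRepro.C025ProfileTopHallDisjoint

/-!
# THE HALL FORM (C-033) OF THE TOP ROW `(q, ρ(E))` ON EVERY FINITE MATROID (night-3 g21)

At the level `u = ρ(E)` the price of a rank-`q` set `B` is `1` when `E ∖ B` is spanning and `0` otherwise, and
the level-`u` sets are the spanning sets.  So the Hall form of the row `(q, ρ(E))` says: for every family `𝒜` of
rank-`q` sets, `#{B ∈ 𝒜 : E ∖ B spanning} ≤ #{S spanning : S ⊇ some B ∈ 𝒜}`.  In the dual matroid `M✶` a set
with spanning complement is independent and a spanning set is the complement of an independent set, so this is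
the disjointness lemma of the companion module applied to `M✶` and the family `{B ∈ 𝒜 : E ∖ B spanning}`:
the independent sets `T` of `M✶` disjoint from a member `B` number at least the members, and `S = E ∖ T` is a
spanning superset of `B`.
* `spanning_of_eRk_eq_eRank` — a set of rank `ρ(E)` is spanning (a basis of it is a base);
* `gr_dual` — the ground Finset of `M✶`;  `price_eq_ite_of_eRank_eq` — the price at the top level is `0` or `1`;
* **`hallIneq_of_eRank_eq (hu : M.eRank = u) (q) : Profile.HallIneq M q u`** — the Hall form of the top row, every
  `q`, every finite matroid; **`hallIneq_top (q) : Profile.HallIneq M q (rkN M (gr M))`**;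
* **`hallIneq_of_circuits_ge_eRank_sub_one (h : ∀ C, M.IsCircuit C → M.eRank ≤ |C| + 1) (q u) (q < u) :
  Profile.HallIneq M q u`** — the Hall form of EVERY row on every matroid whose circuits all have `≥ ρ(E) − 1`
  points (the level `u = ρ(E)` is the top row; below it the table theorem at girth `≥ u`; above it trivial).
No `def`, no `instance`, no notation.  Axioms: standard.
-/

open scoped Matroid

namespace PercRepro

open Set Finset ThmH Staged

namespace TopHall

variable {α : Type} [DecidableEq α] {M : Matroid α} [M.Finite]

omit [DecidableEq α] in
/-- A subset of the ground set of rank `ρ(E)` is spanning: a basis of it has `ρ(E)` points and is a base. -/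
theorem spanning_of_eRk_eq_eRank {X : Set α} (hX : X ⊆ M.E) (h : M.eRk X = M.eRank) : M.Spanning X := by
  obtain ⟨I, hI⟩ := M.exists_isBasis X hX
  have hIcard : I.encard = M.eRank := by rw [hI.encard_eq_eRk, h]
  have hIfin : I.encard ≠ ⊤ :=
    (Set.Finite.subset Matroid.Finite.ground_finite (hI.indep.subset_ground)).encard_lt_top.ne
  have hbase : M.IsBase I := by
    apply hI.indep.isBase_of_forall_insert
    intro e he hins
    have h1 : (insert e I).encard ≤ M.eRank := hins.encard_le_eRank
    rw [Set.encard_insert_of_notMem he.2, hIcard] at h1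
    rw [← hIcard] at h1
    exact lt_irrefl _ ((ENat.add_one_le_iff hIfin).1 h1)
  exact (Matroid.spanning_iff_exists_isBase_subset hX).2 ⟨I, hbase, hI.subset⟩

omit [DecidableEq α] in
/-- The ground Finset of the dual matroid. -/
theorem gr_dual : gr (M✶) = gr M := by
  apply Finset.coe_injective
  rw [coe_gr, coe_gr, Matroid.dual_ground]

/-- At the level `u = ρ(E)` the price of a rank-`q` set `B` is `1` if `ρ(E ∖ B) = ρ(E)` and `0` otherwise. -/
theorem price_eq_ite_of_eRank_eq {q u : ℕ} (hu : M.eRank = u) (B : Finset α) :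
    Profile.price M q u B = if (u : ℕ∞) ≤ M.eRk ((gr M \ B : Finset α) : Set α) then 1 else 0 := by
  unfold Profile.price
  split_ifs with h
  · have h1 : M.eRk ((gr M \ B : Finset α) : Set α) = u :=
      le_antisymm ((M.eRk_le_eRank _).trans hu.le) h
    rw [h1, ENat.toNat_coe, Nat.choose_symm_add]
    exact div_self (Nat.cast_ne_zero.2 (Nat.choose_pos (Nat.le_add_left q u)).ne')
  · rfl

open scoped Classical in
/-- **THE HALL FORM (C-033) OF THE TOP ROW `(q, ρ(E))` ON EVERY FINITE MATROID**: for every family `𝒜` of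
rank-`q` sets, the spanning sets containing a member of `𝒜` number at least the members whose complement is
spanning — the disjointness lemma in the dual matroid. -/
theorem hallIneq_of_eRank_eq {q u : ℕ} (hu : M.eRank = u) : Profile.HallIneq M q u := by
  intro 𝒜 h𝒜
  -- the total price is the number of members with spanning complement
  have hsum : ∑ B ∈ 𝒜, Profile.price M q u B =
      ((𝒜.filter (fun B : Finset α => (u : ℕ∞) ≤ M.eRk ((gr M \ B : Finset α) : Set α))).card : ℚ) := by
    rw [Finset.sum_congr rfl (fun B _ => price_eq_ite_of_eRank_eq hu B), Finset.sum_boole]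
  rw [hsum]
  -- those members are independent in the dual matroid
  have hcoind : ∀ B ∈ 𝒜.filter (fun B : Finset α => (u : ℕ∞) ≤ M.eRk ((gr M \ B : Finset α) : Set α)),
      (M✶).Indep (B : Set α) := by
    intro B hB
    rw [Finset.mem_filter] at hB
    have hBg : (B : Set α) ⊆ M.E := by
      rw [← coe_gr]
      exact Finset.coe_subset.2 (Profile.mem_Rq.1 (h𝒜 hB.1)).1
    have h1 : M.eRk ((gr M \ B : Finset α) : Set α) = M.eRank :=
      le_antisymm (M.eRk_le_eRank _) (by rw [hu]; exact hB.2)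
    rw [Finset.coe_sdiff, coe_gr] at h1
    have h2 : M.Spanning (M.E \ (B : Set α)) :=
      spanning_of_eRk_eq_eRank Set.sdiff_subset h1
    exact Matroid.coindep_def.1 ((Matroid.coindep_iff_compl_spanning hBg).2 h2)
  -- the disjointness lemma in M✶
  have hdisj := card_le_card_indep_disjoint (M✶)
    (𝒜.filter (fun B : Finset α => (u : ℕ∞) ≤ M.eRk ((gr M \ B : Finset α) : Set α))) hcoind
  -- the complements of the candidates are spanning supersets of members of 𝒜
  have hmap : ((gr (M✶)).powerset.filter (fun T : Finset α => (M✶).Indep (T : Set α) ∧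
      ∃ B ∈ 𝒜.filter (fun B : Finset α => (u : ℕ∞) ≤ M.eRk ((gr M \ B : Finset α) : Set α)),
        Disjoint T B)).card ≤ (Shadow.shadowLevel M u 𝒜).card := by
    apply Finset.card_le_card_of_injOn (fun T : Finset α => gr M \ T)
    · intro T hT
      rw [Finset.mem_coe, Finset.mem_filter, Finset.mem_powerset, gr_dual] at hT
      obtain ⟨hTg, hTi, B, hB, hdis⟩ := hT
      rw [Finset.mem_coe, mem_shadowLevel, Profile.mem_levelSet]
      refine ⟨⟨Finset.sdiff_subset, ?_⟩, B, (Finset.mem_filter.1 hB).1, ?_⟩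
      · have h1 : M.Spanning (M.E \ (T : Set α)) := (Matroid.coindep_def.2 hTi).compl_spanning
        rw [Finset.coe_sdiff, coe_gr, h1.eRk_eq, hu]
      · rw [Finset.subset_sdiff]
        exact ⟨(Profile.mem_Rq.1 (h𝒜 (Finset.mem_filter.1 hB).1)).1, hdis.symm⟩
    · intro T hT T' hT' heq
      rw [Finset.mem_coe, Finset.mem_filter, Finset.mem_powerset, gr_dual] at hT hT'
      simp only at heq
      rw [← Finset.sdiff_sdiff_eq_self hT.1, ← Finset.sdiff_sdiff_eq_self hT'.1, heq]
  exact_mod_cast hdisj.trans hmap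

/-- **The Hall form of the top row `(q, ρ(E))`**, with the level written as the rank of the ground Finset. -/
theorem hallIneq_top (q : ℕ) : Profile.HallIneq M q (rkN M (gr M)) := by
  apply hallIneq_of_eRank_eq
  rw [Staged.coe_rkN, coe_gr, Matroid.eRk_ground]

omit [DecidableEq α] in
/-- In a matroid whose circuits all have at least `ρ(E) − 1` points, every set of fewer than `u` points is
independent when `u + 1 ≤ ρ(E)`. -/
theorem indep_of_encard_add_one_le_of_circuits_ge_eRank_sub_one
    (h : ∀ C, M.IsCircuit C → M.eRank ≤ C.encard + 1) {u : ℕ} (hu : (u : ℕ∞) + 1 ≤ M.eRank) :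
    ∀ T ⊆ M.E, T.encard + 1 ≤ (u : ℕ∞) → M.Indep T := by
  intro T hT hTu
  by_contra hind
  obtain ⟨C, hCT, hC⟩ := ((Matroid.not_indep_iff hT).1 hind).exists_isCircuit_subset
  have h1 : T.encard + 1 + 1 ≤ T.encard + 1 :=
    calc T.encard + 1 + 1 ≤ (u : ℕ∞) + 1 := add_le_add hTu le_rfl
      _ ≤ M.eRank := hu
      _ ≤ C.encard + 1 := h C hC
      _ ≤ T.encard + 1 := add_le_add (Set.encard_le_encard hCT) le_rfl
  have h2 : T.encard + 1 ≠ ⊤ := by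
    have := (Set.Finite.subset Matroid.Finite.ground_finite hT).encard_lt_top.ne
    exact WithTop.add_ne_top.2 ⟨this, WithTop.one_ne_top⟩
  exact lt_irrefl _ ((ENat.add_one_le_iff h2).1 h1)

/-- **The Hall form (C-033) of every row `(q, u)`, `q < u`, on every finite matroid whose circuits all have at
least `ρ(E) − 1` points** (one step beyond paving): `u + 1 ≤ ρ(E)` by the table theorem at girth `≥ u`,
`u = ρ(E)` by the top-row theorem, `u > ρ(E)` trivially. -/
theorem hallIneq_of_circuits_ge_eRank_sub_one (h : ∀ C, M.IsCircuit C → M.eRank ≤ C.encard + 1) (q u : ℕ)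
    (hqu : q < u) : Profile.HallIneq M q u := by
  by_cases hu1 : (u : ℕ∞) + 1 ≤ M.eRank
  · exact GirthRows.hallIneq_of_girth_table q u hqu
      (indep_of_encard_add_one_le_of_circuits_ge_eRank_sub_one h hu1)
  · rw [not_le] at hu1
    by_cases hu2 : M.eRank = u
    · exact hallIneq_of_eRank_eq hu2
    · apply GirthRows.hallIneq_of_eRank_lt
      have h3 : M.eRank ≤ (u : ℕ∞) := by
        have := (ENat.lt_add_one_iff (ENat.coe_ne_top u)).1 hu1
        exact this
      exact lt_of_le_of_ne h3 hu2

end TopHall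

end PercRepro
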